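import Mathlib
import Literature.AlgebraicGeometry.Resolution.CobordantGame
import Literature.AlgebraicGeometry.Resolution.CobordantChartCoefficients
import Literature.AlgebraicGeometry.Resolution.CobordantChartPlaneSlice
import Literature.AlgebraicGeometry.Resolution.AxisPolyhedron
import Summits.ResolutionOfSingularities.ResolutionOfSingularities.Theorems.WeightedInvariantLocalWeightedDropAxisWeightedMoveCone
import Summits.ResolutionOfSingularities.ResolutionOfSingularities.Theorems.WeightedInvariantLocalWeightedDropAxisWeightedMoveTranslate
import Summits.ResolutionOfSingularities.ResolutionOfSingularities.Theorems.WeightedInvariantLocalWeightedDropAxisWeightedMoveSlice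

/-!
# `WeightedInvariant.LocalWeightedDrop`, line `hasse-ridge-face-selection`: the weighted move (B2), part 4 —
# the slice at the axis point is again an axis germ with `δ < 2` when the level-`(m+1)` line is empty

Crux item stmt-ResolutionOfSingularities-8899 (route `ResolutionOfSingularities/WeightedInvariant`), skeleton v18 of
the line `hasse-ridge-face-selection`, helpers toward stub `stub_axisWeightedMove` (B2).

Setting of part 3: the weighted move `(X, (m, …, m, 1))` from an axis germ `g` of order `d` above the level `m`, the
axis point `c = (0, c_z)`, `c_z ≠ 0`, of the exceptional divisor, `g(chart) = s^{md} · G`, the slice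
`Sl = G|_{y_z = 0} ∈ k[[s, y']]`.  Here: the sub-case `δ(g) ≥ m + 1` with EMPTY level-`(m+1)` line (so
`m + 1 < δ(g) < m + 2`).  After the rotation of variables `(s, y') ↦ (y', s)` (`MvPowerSeries.rename` along
`(finRotate (n+1)).symm`, so that `s` becomes the free variable `Fin.last n` of the axis vocabulary), the slice is an
axis germ `S` of order `d` with the SAME degree-`d` form `F` (`AxisCone`, `TrivialApexX` inherited from `g`) and with
`δ(S) = δ(g) - m < 2` (`¬ AboveLevel d 2 1 S`, witnessed by the monomial of `g` below the level `m + 2`); so the point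
move B3 (taken as a hypothesis, as in the registered signature of B2) wins `S`, and `Sl` with it (`won_subst_iff`:
a permutation of the variables is a legal coordinate change).
* `coeff_rename_rot` — `coeff e (rotated Sl) = coeff (e_z, e') Sl`;
* `won_slice_of_lineEmpty` — the conclusion `Won Sl`.
-/

set_option linter.dupNamespace false -- mandated namespace of this single-conjunct summit

namespace Summit.ResolutionOfSingularities.ResolutionOfSingularities.Theorems

open Literature.AlgebraicGeometry.Resolution

namespace AxisWeightedMove

variable {k : Type} [Field k] {n : ℕ}

/-! ### The rotation `s ↦ z`, `y'_j ↦ x'_j` -/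

/-- The rotation sends the `s`-slot `0` to the free slot `Fin.last n`. -/
theorem rot_zero : (finRotate (n + 1)).symm 0 = Fin.last n := by
  rw [Equiv.symm_apply_eq]
  exact finRotate_last.symm

/-- The rotation sends the slot `j.succ` of `y'_j` to the slot `Fin.castSucc j` of `x'_j`. -/
theorem rot_succ (j : Fin n) : (finRotate (n + 1)).symm j.succ = Fin.castSucc j := by
  rw [Equiv.symm_apply_eq]
  ext
  rw [coe_finRotate_of_ne_last (Fin.castSucc_lt_last j).ne]
  simp

/-- Every exponent of the rotated variables is the rotation of `(e_z, e')`. -/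
theorem mapDomain_rot (e : Fin (n + 1) →₀ ℕ) :
    Finsupp.mapDomain (⇑(finRotate (n + 1)).symm)
      (Finsupp.cons (e (Fin.last n)) (Finsupp.equivFunOnFinite.symm fun j : Fin n => e (Fin.castSucc j))) = e := by
  ext i
  obtain ⟨i₀, rfl⟩ : ∃ i₀, (finRotate (n + 1)).symm i₀ = i := ⟨finRotate (n + 1) i, Equiv.symm_apply_apply _ _⟩
  rw [Finsupp.mapDomain_apply (Equiv.injective _)]
  refine Fin.cases ?_ (fun j => ?_) i₀
  · rw [Finsupp.cons_zero, rot_zero]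
  · rw [Finsupp.cons_succ, rot_succ, Finsupp.coe_equivFunOnFinite_symm]

/-- COEFFICIENTS OF THE ROTATED SERIES: `coeff e (rotated f) = coeff (e_z, e') f`. -/
theorem coeff_rename_rot (f : MvPowerSeries (Fin (n + 1)) k) (e : Fin (n + 1) →₀ ℕ) :
    MvPowerSeries.coeff e (MvPowerSeries.rename (⇑(finRotate (n + 1)).symm) f) =
      MvPowerSeries.coeff (Finsupp.cons (e (Fin.last n))
        (Finsupp.equivFunOnFinite.symm fun j : Fin n => e (Fin.castSucc j))) f := by
  conv_lhs => rw [← mapDomain_rot e]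
  have h := MvPowerSeries.coeff_embDomain_rename (finRotate (n + 1)).symm.toEmbedding f
    (Finsupp.cons (e (Fin.last n)) (Finsupp.equivFunOnFinite.symm fun j : Fin n => e (Fin.castSucc j)))
  rw [Finsupp.embDomain_eq_mapDomain] at h
  exact h

/-- The rotation is a legal coordinate change: `Won (rotated f) ↔ Won f`. -/
theorem won_rename_rot_iff (f : MvPowerSeries (Fin (n + 1)) k) :
    CobordantGame.Won k (n + 1) (MvPowerSeries.rename (⇑(finRotate (n + 1)).symm) f) ↔
      CobordantGame.Won k (n + 1) f := by
  rw [MvPowerSeries.rename_eq_subst]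
  have hψ0 : ∀ i, MvPowerSeries.constantCoeff
      ((MvPowerSeries.X ∘ ⇑(finRotate (n + 1)).symm : Fin (n + 1) → MvPowerSeries (Fin (n + 1)) k) i) = 0 :=
    fun i => MvPowerSeries.constantCoeff_X _
  refine won_subst_iff hψ0 (isUnit_det_linMat_of_comp_eq_X
    (φ := fun s => MvPowerSeries.X (finRotate (n + 1) s)) hψ0 fun s => ?_) f
  rw [MvPowerSeries.subst_X (MvPowerSeries.hasSubst_of_constantCoeff_zero hψ0), Function.comp_apply,
    Equiv.symm_apply_apply]

/-! ### The rotated slice is an axis germ with `δ < 2` -/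

section AxisPoint

variable {w : Fin (n + 1) → ℕ} {m : ℕ} (hw1 : w (Fin.last n) = 1) (hwm : ∀ j, w (Fin.castSucc j) = m)
  (hm : 1 ≤ m) {d : ℕ} {g : MvPowerSeries (Fin (n + 1)) k} {c : Fin (n + 1) → k}
  {G : MvPowerSeries (Fin (n + 2)) k}
  (hfac : MvPowerSeries.subst (CobordantChart.chart w c) g = MvPowerSeries.X 0 ^ (m * d) * G)
  (hc' : ∀ j : Fin n, c (Fin.castSucc j) = 0)

include hw1 hwm hm hfac hc' in
/-- THE SLICE AT THE AXIS POINT IS WON WHEN THE LEVEL-`(m+1)` LINE IS EMPTY (and `δ(g) < m + 2`), given the point move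
B3 for axis germs with `δ < 2` and the singular germs of order `< d`: the rotated slice `S` is singular of order `d`,
`AxisCone d S` (a degree-`d` monomial `s^r y'^b`, `r > 0`, of `Sl` would come from the level-`(m+1)` line),
`TrivialApexX d S` (the degree-`d` form of `S` is `F`), and the monomial `x'^a z^e` of `g` with `e < (m+2)(d-|a|)`
gives the monomial `y'^a s^{e - m(d-|a|)}` of `S` below the level `2`. -/
theorem won_slice_of_lineEmpty (hcz : c (Fin.last n) ≠ 0) (hlev : AxisPolyhedron.AboveLevel d m 1 g)
    (hlev1 : AxisPolyhedron.AboveLevel d (m + 1) 1 g)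
    (hempty : ∀ E : Fin (n + 1) →₀ ℕ, AxisPolyhedron.xDeg E < d →
      E (Fin.last n) = (m + 1) * (d - AxisPolyhedron.xDeg E) → MvPowerSeries.coeff E g = 0)
    (hcone : AxisPolyhedron.AxisCone d g) (hapex : AxisPolyhedron.TrivialApexX d g) (hgd : g.order = d)
    (hg : g ≠ 0) (hd2 : 2 ≤ d) {E₀ : Fin (n + 1) →₀ ℕ} (hE₀x : AxisPolyhedron.xDeg E₀ < d)
    (hE₀g : MvPowerSeries.coeff E₀ g ≠ 0) (hE₀z : E₀ (Fin.last n) < (m + 2) * (d - AxisPolyhedron.xDeg E₀))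
    (hB3 : ∀ S : MvPowerSeries (Fin (n + 1)) k, CobordantGame.IsSingular k S → S.order = d →
      AxisPolyhedron.AxisCone d S → AxisPolyhedron.TrivialApexX d S → ¬ AxisPolyhedron.AboveLevel d 2 1 S →
      (∀ h : MvPowerSeries (Fin (n + 1)) k, CobordantGame.IsSingular k h → h.order < S.order →
        CobordantGame.Won k (n + 1) h) →
      CobordantGame.Won k (n + 1) S)
    (hord : ∀ h : MvPowerSeries (Fin (n + 1)) k, CobordantGame.IsSingular k h → h.order < (d : ℕ∞) →
      CobordantGame.Won k (n + 1) h) :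
    CobordantGame.Won k (n + 1) (MvPowerSeries.subst (fun j : Fin (n + 2) =>
        if j = (Fin.last n).succ then (0 : MvPowerSeries (Fin (n + 1)) k)
        else MvPowerSeries.X (Fin.predAbove (Fin.last n) j)) G) := by
  set Sl := MvPowerSeries.subst (fun j : Fin (n + 2) =>
    if j = (Fin.last n).succ then (0 : MvPowerSeries (Fin (n + 1)) k)
    else MvPowerSeries.X (Fin.predAbove (Fin.last n) j)) G with hSl
  set S := MvPowerSeries.rename (⇑(finRotate (n + 1)).symm) Sl with hS
  have hcoS : ∀ e : Fin (n + 1) →₀ ℕ, MvPowerSeries.coeff e S = MvPowerSeries.coeff (Finsupp.cons (e (Fin.last n))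
      (Finsupp.equivFunOnFinite.symm fun j : Fin n => e (Fin.castSucc j))) Sl := coeff_rename_rot Sl
  have hSlord : Sl.order = d := order_slice_eq hw1 hwm hm hfac hc' hlev1 hcone hgd hg
  -- the pure-`x'` coefficients of `S` in degree `d` are those of `g`
  have htop : ∀ b : Fin n →₀ ℕ, b.degree = d →
      MvPowerSeries.coeff (Finsupp.equivFunOnFinite.symm (Fin.snoc (⇑b) 0 : Fin (n + 1) → ℕ)) S =
        MvPowerSeries.coeff (Finsupp.equivFunOnFinite.symm (Fin.snoc (⇑b) 0 : Fin (n + 1) → ℕ)) g := by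
    intro b hb
    rw [hcoS, snoc_last, xPart_snoc, hSl, coeff_slice_top hw1 hwm hm hfac hc' hb]
  -- `S` has order `d`
  have hSord : S.order = d := by
    apply le_antisymm
    · obtain ⟨E, hE, hEd⟩ := MvPowerSeries.exists_coeff_ne_zero_and_order
        ((MvPowerSeries.ne_zero_iff_order_finite).mp hg)
      rw [hgd, Nat.cast_inj] at hEd
      have hEz : E (Fin.last n) = 0 := by
        by_contra h
        exact hE (hcone E hEd h)
      have hxd : (Finsupp.equivFunOnFinite.symm fun j : Fin n => E (Fin.castSucc j)).degree = d := by
        rw [← xDeg_eq_degree_xPart]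
        rw [AxisMove.degree_eq_xDeg_add, hEz, add_zero] at hEd
        exact hEd
      have hne : MvPowerSeries.coeff E S ≠ 0 := by
        have h := htop _ hxd
        rw [← hEz, snoc_xPart] at h
        rw [h]
        exact hE
      refine (MvPowerSeries.order_le hne).trans ?_
      exact_mod_cast hEd.le
    · refine MvPowerSeries.nat_le_order fun e he => ?_
      rw [hcoS]
      refine MvPowerSeries.coeff_of_lt_order ?_
      rw [hSlord, Literature.NumberTheory.Transcendental.NguyenRoy.degree_cons_eq, ← xDeg_eq_degree_xPart]
      rw [AxisMove.degree_eq_xDeg_add] at he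
      exact_mod_cast (show e (Fin.last n) + AxisPolyhedron.xDeg e < d by omega)
  have hSsing : CobordantGame.IsSingular k S := by
    refine ⟨fun h0 => ?_, (FormalCoordChange.two_le_order_iff _).mp ?_⟩
    · rw [h0, MvPowerSeries.order_zero] at hSord
      exact ENat.top_ne_coe d hSord
    · rw [hSord]
      exact_mod_cast hd2
  -- `AxisCone d S`: degree-`d` monomials with `s` come from the (empty) level-`(m+1)` line
  have hScone : AxisPolyhedron.AxisCone d S := by
    intro e hed hez
    rw [hcoS, hSl, coeff_slice hw1 hwm hm hfac hc', ← xDeg_eq_degree_xPart]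
    split_ifs with hle
    · rw [AxisMove.degree_eq_xDeg_add] at hed
      have hsplit : m * d = m * AxisPolyhedron.xDeg e + m * (d - AxisPolyhedron.xDeg e) := by
        rw [← Nat.mul_add]
        congr 1
        omega
      rw [hempty _ (by rw [xDeg_snoc, ← xDeg_eq_degree_xPart]; omega) (by
        rw [xDeg_snoc, snoc_last, ← xDeg_eq_degree_xPart, Nat.add_mul, one_mul]
        omega), zero_mul]
    · rfl
  -- `TrivialApexX d S`: the degree-`d` form of `S` is that of `g`
  have hinit : ∀ v : Fin n → k, CobordantChart.initEval (fun _ : Fin (n + 1) => 1) (Fin.snoc v 0 : Fin (n + 1) → k) d S =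
      CobordantChart.initEval (fun _ : Fin (n + 1) => 1) (Fin.snoc v 0 : Fin (n + 1) → k) d g := by
    intro v
    rw [initEval_snoc_zero hScone, initEval_snoc_zero hcone]
    refine Finset.sum_congr rfl fun b hb => ?_
    rw [htop b ((mem_antidiag_iff_degree d b).mp hb)]
  have hSapex : AxisPolyhedron.TrivialApexX d S := by
    intro u hu
    obtain ⟨v, hv⟩ := hapex u hu
    refine ⟨v, ?_⟩
    rw [snoc_add_snoc, hinit, hinit, ← snoc_add_snoc]
    exact hv
  -- `δ(S) < 2`: the witness below the level `m + 2`
  have hge : m * (d - AxisPolyhedron.xDeg E₀) ≤ E₀ (Fin.last n) := by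
    by_contra hlt
    push Not at hlt
    exact hE₀g (hlev E₀ hE₀x (by rw [one_mul]; exact hlt))
  have hsplit₀ : m * d = m * AxisPolyhedron.xDeg E₀ + m * (d - AxisPolyhedron.xDeg E₀) := by
    rw [← Nat.mul_add, Nat.add_sub_cancel' hE₀x.le]
  have hSlev : ¬ AxisPolyhedron.AboveLevel d 2 1 S := by
    intro hA
    have h := hA (Finsupp.equivFunOnFinite.symm (Fin.snoc
      (⇑(Finsupp.equivFunOnFinite.symm fun j : Fin n => E₀ (Fin.castSucc j)))
      (m * AxisPolyhedron.xDeg E₀ + E₀ (Fin.last n) - m * d) : Fin (n + 1) → ℕ))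
      (by rw [xDeg_snoc, ← xDeg_eq_degree_xPart]; exact hE₀x)
      (by
        rw [xDeg_snoc, snoc_last, ← xDeg_eq_degree_xPart, one_mul]
        have : (m + 2) * (d - AxisPolyhedron.xDeg E₀) =
            m * (d - AxisPolyhedron.xDeg E₀) + 2 * (d - AxisPolyhedron.xDeg E₀) := by ring
        omega)
    rw [hcoS, snoc_last, xPart_snoc, hSl, coeff_slice_of hw1 hwm hm hfac hc' E₀ (by omega)] at h
    exact (mul_ne_zero hE₀g (pow_ne_zero _ hcz)) h
  -- B3 wins `S`, and `Sl` with it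
  have hWS : CobordantGame.Won k (n + 1) S :=
    hB3 S hSsing hSord hScone hSapex hSlev fun h hh hlt => hord h hh (hSord ▸ hlt)
  rw [hS] at hWS
  exact (won_rename_rot_iff Sl).mp hWS

end AxisPoint

end AxisWeightedMove

end Summit.ResolutionOfSingularities.ResolutionOfSingularities.Theorems
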